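import Summits.CriticalPhenomena.PercolationContinuityZ3.Theorems.PercNearOneGluingNoHeavyLowerTailSahiCoordinateTwoThirds
import Summits.CriticalPhenomena.PercolationContinuityZ3.Theorems.PercNearOneGluingNoHeavyLowerTailSahiBlockExchangeable
import Summits.CriticalPhenomena.PercolationContinuityZ3.Theorems.PercNearOneGluingNoHeavyLowerTailSahiChordSuperlinearRefuted
import Mathlib.Tactic.NormNum
import HarnessLib

/-!
# `NoHeavyLowerTail` (stmt-CriticalPhenomena-4575) — the two-thirds conjecture (T3∀) ALREADY FAILS ON THE FIVE-CUBE: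
# an explicit `Fin 5` witness (minimal dimension), kernel-evaluated

Support file (cell `prim-l12`, lane prim-bnk-2 gen 14; `--supports stmt-CriticalPhenomena-4575`).  No `sorry`, no definitions, standard axioms.

CONTEXT.  `SahiCoordinateTwoThirds.TwoThirds` ((T3∀): `3B₂(e) ≥ 2B₃(e)` for the degree-3 Bernstein coefficients of
`s ↦ E_3(μ_{p[e↦s]}; 1_A,1_B,1_C)` at every coordinate; it implied Kahn's `C_3`) and `SahiCoordinateAntitone.MasterAntitone 3` are REFUTED in
the tree by their owner (`SahiCoordinateTwoThirdsFalse.not_twoThirds / not_masterAntitone_three`, seat prim-masterthm-p2 gen 13: a SEVEN-coordinate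
class-T triple under the UNIFORM measure, margin `−1/512`).  This file records the independent, dimension-minimal witness found the same day by an
exact p-adversarial search of this lane (engine `adv5.c`: all sub-2 comb cells of `{0,1}^5`, coordinate descent in `p` with exact 1-D cubic steps,
rational re-verification three ways — Bernstein coefficients by interpolation, the owner's closed form, and the lane's two-level form
`3B₂ − 2B₃ = T⁺(U¹,U⁰) − E_3(U¹)`, `T⁺ = twoLevelForm − ∏δ` of `…SahiTwoLevelC3`):

  `ι = Fin 5`, `e = 2`, `p = (1/3, 1/2, 1/2, 1/2, 1/3)` (all coordinates non-degenerate),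
  `A = {x₀ ∧ (x₁ ∨ x₂)}`, `B = {x₄ ∧ (x₂ ∨ x₃)}`, `C = {x₀x₁ ∨ x₁x₂x₃ ∨ x₃x₄}`
— the reflection-symmetric "path" triple at which the topform TOP-MIX ratio attains its `m = 5` minimum `17/9` (prim-bnk-2 gen 13) — has
`B₀ = E_3(A⁰,B⁰,C⁰) = 0`, `B₁ = 49/3888`, `B₂ = 31/1296`, `B₃ = E_3(A¹,B¹,C¹) = 1/27`, hence **`3B₂ − 2B₃ = −1/432`** (`witness_value`), i.e.
(T3) fails at `e = 2` (`twoThirds_fails_on_fin_five`).  The lane's weaker TOP law `SahiTwoLevelPlus` (`3B₂ ≥ B₃`) holds there (`T⁺ = 5/144 > 0`).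

WHY FIVE IS MINIMAL, AND THE UNIFORM MEASURE (census of this seat, exact integers, not kernel facts): the coefficientwise form `c₂ ≥ 2c₃` of (T3) holds
for every comb line on `≤ 4` coordinates (ttrl topform, m ≤ 4 exhaustive: no cell with `c₂ < 2c₃`), so (T3∀) is TRUE for all triples on `≤ 4`
coordinates and every `p`; the 850 sub-2 cells of `{0,1}^5` are where it can fail, and for 2 758 of the 4 836 sub-2 configurations `(A,B,C,e)` some
`p` makes `3B₂ − 2B₃ < 0`.  At UNIFORM parameters on `{0,1}^5` (exhaustive: 210 `S₅`-classes of `A` × all 7 581 `B` × 5 axes × exact minimum over all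
up-sets `C` by min cut): `q ≡ 1/2` — 0 violations; `q ≡ 1/3` — violations exist (e.g. this triple, margin `−972/3¹²`).  So parameter grids through `1/2`
and the `k = 4` exhaustive censuses could not see the failure.

Technique (as in `…SahiChordSuperlinearRefuted`): `coordPiece₂_eq` and `sahiE_three_apply` turn the quantity into expectations of indicators under
`bernoulliWeight p`; `ex_bernoulliWeight_eq_sum_cube` transports each to a sum over the Boolean cube `Fin 5 → Bool` (`cubeEquivSet`,
`bernoulliWeight_comp_cubeEquivSet`), which `SahiChordSuperlinear.sum_cube_succ/_zero` peel coin by coin; `simp` (with `decide := true` for the `Fin 5`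
literals) decides the 32 memberships and `norm_num` does the arithmetic (raised heartbeats for this finite evaluation only).  Axioms standard. [this work]
-/

namespace Summit.CriticalPhenomena.PercolationContinuityZ3.Theorems

namespace SahiCoordinateTwoThirds

open Finset Function
open Literature.Combinatorics.Sahi2008
open Literature.Probability.Percolation.DecisionTree (ind ind_of_mem ind_of_not_mem ind_nonneg)
open SahiCoordinateBernstein (coordPiece₂)
open SahiBlockExchangeable (cubeEquivSet mem_cubeEquivSet bernoulliWeight_comp_cubeEquivSet)
open SahiChordSuperlinear (sum_cube_succ sum_cube_zero)

/-- Transport of an expectation under the product weight on `Set (Fin k)` to a sum over the Boolean cube `Fin k → Bool`. [folklore] -/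
theorem ex_bernoulliWeight_eq_sum_cube {k : ℕ} (p : Fin k → unitInterval) (f : Set (Fin k) → ℝ) :
    ex (bernoulliWeight p) f = ∑ y : Fin k → Bool, coinWeight (fun i => (p i : ℝ)) y * f (cubeEquivSet k y) := by
  unfold ex
  rw [← (cubeEquivSet k).sum_comp (fun S => bernoulliWeight p S * f S)]
  refine Finset.sum_congr rfl fun y _ => ?_
  rw [show bernoulliWeight p (cubeEquivSet k y) = (bernoulliWeight p ∘ cubeEquivSet k) y from rfl,
    bernoulliWeight_comp_cubeEquivSet]

/-- The three witness events are increasing. [this work] -/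
theorem isUpperSet_witnessA :
    IsUpperSet ({S : Set (Fin 5) | (0 : Fin 5) ∈ S ∧ ((1 : Fin 5) ∈ S ∨ (2 : Fin 5) ∈ S)} : Set (Set (Fin 5))) := by
  intro S T hST h
  exact ⟨hST h.1, h.2.imp (fun h1 => hST h1) (fun h2 => hST h2)⟩

/-- The three witness events are increasing. [this work] -/
theorem isUpperSet_witnessB :
    IsUpperSet ({S : Set (Fin 5) | (4 : Fin 5) ∈ S ∧ ((2 : Fin 5) ∈ S ∨ (3 : Fin 5) ∈ S)} : Set (Set (Fin 5))) := by
  intro S T hST h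
  exact ⟨hST h.1, h.2.imp (fun h1 => hST h1) (fun h2 => hST h2)⟩

/-- The three witness events are increasing. [this work] -/
theorem isUpperSet_witnessC :
    IsUpperSet ({S : Set (Fin 5) | ((0 : Fin 5) ∈ S ∧ (1 : Fin 5) ∈ S) ∨ ((1 : Fin 5) ∈ S ∧ (2 : Fin 5) ∈ S ∧ (3 : Fin 5) ∈ S) ∨
      ((3 : Fin 5) ∈ S ∧ (4 : Fin 5) ∈ S)} : Set (Set (Fin 5))) := by
  intro S T hST h
  rcases h with ⟨h0, h1⟩ | ⟨h1, h2, h3⟩ | ⟨h3, h4⟩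
  · exact Or.inl ⟨hST h0, hST h1⟩
  · exact Or.inr (Or.inl ⟨hST h1, hST h2, hST h3⟩)
  · exact Or.inr (Or.inr ⟨hST h3, hST h4⟩)

set_option maxHeartbeats 4000000 in
-- finite exact evaluation of ≈ 25 expectations over the 32-point cube; nothing else is affected
/-- **The witness value**: at `p = (1/3,1/2,1/2,1/2,1/3)`, `e = 2` and the path triple of the module docstring,
`coordPiece₂ + E_3(0-sections) = −1/432`. [this work] -/
theorem witness_value (h3 : (1/3 : ℝ) ∈ unitInterval) (h2 : (1/2 : ℝ) ∈ unitInterval) :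
    coordPiece₂ (![⟨1/3, h3⟩, ⟨1/2, h2⟩, ⟨1/2, h2⟩, ⟨1/2, h2⟩, ⟨1/3, h3⟩] : Fin 5 → unitInterval) 2
        ![({S : Set (Fin 5) | (0 : Fin 5) ∈ S ∧ ((1 : Fin 5) ∈ S ∨ (2 : Fin 5) ∈ S)} : Set (Set (Fin 5))),
          {S : Set (Fin 5) | (4 : Fin 5) ∈ S ∧ ((2 : Fin 5) ∈ S ∨ (3 : Fin 5) ∈ S)},
          {S : Set (Fin 5) | ((0 : Fin 5) ∈ S ∧ (1 : Fin 5) ∈ S) ∨ ((1 : Fin 5) ∈ S ∧ (2 : Fin 5) ∈ S ∧ (3 : Fin 5) ∈ S) ∨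
            ((3 : Fin 5) ∈ S ∧ (4 : Fin 5) ∈ S)}] +
      sahiE (bernoulliWeight (![⟨1/3, h3⟩, ⟨1/2, h2⟩, ⟨1/2, h2⟩, ⟨1/2, h2⟩, ⟨1/3, h3⟩] : Fin 5 → unitInterval)) 3
        ![ind (secAt 2 false ({S : Set (Fin 5) | (0 : Fin 5) ∈ S ∧ ((1 : Fin 5) ∈ S ∨ (2 : Fin 5) ∈ S)} : Set (Set (Fin 5)))),
          ind (secAt 2 false ({S : Set (Fin 5) | (4 : Fin 5) ∈ S ∧ ((2 : Fin 5) ∈ S ∨ (3 : Fin 5) ∈ S)} : Set (Set (Fin 5)))),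
          ind (secAt 2 false ({S : Set (Fin 5) | ((0 : Fin 5) ∈ S ∧ (1 : Fin 5) ∈ S) ∨
            ((1 : Fin 5) ∈ S ∧ (2 : Fin 5) ∈ S ∧ (3 : Fin 5) ∈ S) ∨ ((3 : Fin 5) ∈ S ∧ (4 : Fin 5) ∈ S)} : Set (Set (Fin 5))))]
      = -(1 / 432 : ℝ) := by
  rw [SahiCoordinateChord.coordPiece₂_eq, sahiE_three_apply]
  simp only [Matrix.cons_val_zero, Matrix.cons_val_one, Matrix.cons_val, ex_bernoulliWeight_eq_sum_cube, Pi.mul_apply, ind,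
    mem_secAt, forceAt, cond_true, cond_false, Set.mem_setOf_eq, Set.mem_inter_iff, Set.mem_sdiff, Set.mem_insert_iff,
    Set.mem_singleton_iff, mem_cubeEquivSet, sum_cube_succ, sum_cube_zero, coinWeight, Fin.prod_univ_succ, Fin.prod_univ_zero,
    Matrix.cons_val_succ, Fin.isValue, Fin.succ_zero_eq_one, Fin.succ_one_eq_two]
  simp (config := { decide := true }) only [if_true, if_false]
  norm_num

/-- **(T3) already fails on the five-cube**: there are a non-degenerate product weight on `Set (Fin 5)`, three increasing events and a coordinate
at which `coordPiece₂ + E_3(0-sections) < 0` (so `TwoThirds` fails in dimension 5 — the least dimension with a sub-2 comb cell; the tree's refutation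
`SahiCoordinateTwoThirdsFalse.not_twoThirds` uses seven coordinates and the uniform measure). [this work] -/
theorem twoThirds_fails_on_fin_five :
    ∃ (p : Fin 5 → unitInterval) (A B C : Set (Set (Fin 5))) (e : Fin 5), IsUpperSet A ∧ IsUpperSet B ∧ IsUpperSet C ∧
      (∀ i, 0 < (p i : ℝ) ∧ (p i : ℝ) < 1) ∧
      coordPiece₂ p e ![A, B, C] +
        sahiE (bernoulliWeight p) 3 ![ind (secAt e false A), ind (secAt e false B), ind (secAt e false C)] < 0 := by
  have h3 : (1/3 : ℝ) ∈ unitInterval := ⟨by norm_num, by norm_num⟩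
  have h2 : (1/2 : ℝ) ∈ unitInterval := ⟨by norm_num, by norm_num⟩
  refine ⟨![⟨1/3, h3⟩, ⟨1/2, h2⟩, ⟨1/2, h2⟩, ⟨1/2, h2⟩, ⟨1/3, h3⟩], _, _, _, 2, isUpperSet_witnessA, isUpperSet_witnessB,
    isUpperSet_witnessC, ?_, ?_⟩
  · intro i
    fin_cases i <;> norm_num
  · rw [witness_value h3 h2]
    norm_num


/-! ### Appendix (same seat, same day): the UNIFORM measure needs six coins — a `Fin 6` witness at `p ≡ 1/2`

At `q ≡ 1/2` (T3∀) holds on all of `{0,1}^5` (exhaustive census, exact), but the seeded m = 6 adversary (`adv6.c`, lifts of the five-cube sub-2 configurations)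
finds uniform-measure violations on `{0,1}^6`: doubling ONE end of the path triple (`x₄ ↦ x₃∧x₅`, the owner's device for emulating a biased coin at `q = 1/2`)
gives `A = x₀(x₁∨x₂)`, `B = x₃x₅(x₂∨x₄)`, `C = x₀x₁ ∨ x₁x₂x₄ ∨ x₃x₄x₅`, `e = 2`, all six coins fair:
`B = (0, 41/3072, 13/512, 5/128)`, **`3B₂ − 2B₃ = −1/512`** — the margin of the owner's seven-coin uniform instance, one coin earlier (and six is minimal for
the uniform measure by the five-cube census). -/

/-- The three six-coin witness events are increasing. [this work] -/
theorem isUpperSet_witness6A :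
    IsUpperSet ({S : Set (Fin 6) | (0 : Fin 6) ∈ S ∧ ((1 : Fin 6) ∈ S ∨ (2 : Fin 6) ∈ S)} : Set (Set (Fin 6))) := by
  intro S T hST h
  exact ⟨hST h.1, h.2.imp (fun h1 => hST h1) (fun h2 => hST h2)⟩

/-- The three six-coin witness events are increasing. [this work] -/
theorem isUpperSet_witness6B :
    IsUpperSet ({S : Set (Fin 6) | (3 : Fin 6) ∈ S ∧ (5 : Fin 6) ∈ S ∧ ((2 : Fin 6) ∈ S ∨ (4 : Fin 6) ∈ S)} : Set (Set (Fin 6))) := by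
  intro S T hST h
  exact ⟨hST h.1, hST h.2.1, h.2.2.imp (fun h1 => hST h1) (fun h2 => hST h2)⟩

/-- The three six-coin witness events are increasing. [this work] -/
theorem isUpperSet_witness6C :
    IsUpperSet ({S : Set (Fin 6) | ((0 : Fin 6) ∈ S ∧ (1 : Fin 6) ∈ S) ∨ ((1 : Fin 6) ∈ S ∧ (2 : Fin 6) ∈ S ∧ (4 : Fin 6) ∈ S) ∨
      ((3 : Fin 6) ∈ S ∧ (4 : Fin 6) ∈ S ∧ (5 : Fin 6) ∈ S)} : Set (Set (Fin 6))) := by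
  intro S T hST h
  rcases h with ⟨h0, h1⟩ | ⟨h1, h2, h4⟩ | ⟨h3, h4, h5⟩
  · exact Or.inl ⟨hST h0, hST h1⟩
  · exact Or.inr (Or.inl ⟨hST h1, hST h2, hST h4⟩)
  · exact Or.inr (Or.inr ⟨hST h3, hST h4, hST h5⟩)

set_option maxHeartbeats 16000000 in
-- finite exact evaluation of ≈ 25 expectations over the 64-point cube; nothing else is affected
/-- **The six-coin uniform witness value**: at `p ≡ 1/2` on `Fin 6`, `e = 2` and the one-end-doubled path triple, `coordPiece₂ + E_3(0-sections) = −1/512`.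
[this work] -/
theorem witness6_value (h2 : (1/2 : ℝ) ∈ unitInterval) :
    coordPiece₂ (fun _ : Fin 6 => (⟨1/2, h2⟩ : unitInterval)) 2
        ![({S : Set (Fin 6) | (0 : Fin 6) ∈ S ∧ ((1 : Fin 6) ∈ S ∨ (2 : Fin 6) ∈ S)} : Set (Set (Fin 6))),
          {S : Set (Fin 6) | (3 : Fin 6) ∈ S ∧ (5 : Fin 6) ∈ S ∧ ((2 : Fin 6) ∈ S ∨ (4 : Fin 6) ∈ S)},
          {S : Set (Fin 6) | ((0 : Fin 6) ∈ S ∧ (1 : Fin 6) ∈ S) ∨ ((1 : Fin 6) ∈ S ∧ (2 : Fin 6) ∈ S ∧ (4 : Fin 6) ∈ S) ∨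
            ((3 : Fin 6) ∈ S ∧ (4 : Fin 6) ∈ S ∧ (5 : Fin 6) ∈ S)}] +
      sahiE (bernoulliWeight (fun _ : Fin 6 => (⟨1/2, h2⟩ : unitInterval))) 3
        ![ind (secAt 2 false ({S : Set (Fin 6) | (0 : Fin 6) ∈ S ∧ ((1 : Fin 6) ∈ S ∨ (2 : Fin 6) ∈ S)} : Set (Set (Fin 6)))),
          ind (secAt 2 false ({S : Set (Fin 6) | (3 : Fin 6) ∈ S ∧ (5 : Fin 6) ∈ S ∧ ((2 : Fin 6) ∈ S ∨ (4 : Fin 6) ∈ S)} : Set (Set (Fin 6)))),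
          ind (secAt 2 false ({S : Set (Fin 6) | ((0 : Fin 6) ∈ S ∧ (1 : Fin 6) ∈ S) ∨ ((1 : Fin 6) ∈ S ∧ (2 : Fin 6) ∈ S ∧ (4 : Fin 6) ∈ S) ∨
            ((3 : Fin 6) ∈ S ∧ (4 : Fin 6) ∈ S ∧ (5 : Fin 6) ∈ S)} : Set (Set (Fin 6))))]
      = -(1 / 512 : ℝ) := by
  rw [SahiCoordinateChord.coordPiece₂_eq, sahiE_three_apply]
  simp only [Matrix.cons_val_zero, Matrix.cons_val_one, Matrix.cons_val, ex_bernoulliWeight_eq_sum_cube, Pi.mul_apply, ind,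
    mem_secAt, forceAt, cond_true, cond_false, Set.mem_setOf_eq, Set.mem_inter_iff, Set.mem_sdiff, Set.mem_insert_iff,
    Set.mem_singleton_iff, mem_cubeEquivSet, sum_cube_succ, sum_cube_zero, coinWeight, Fin.prod_univ_succ, Fin.prod_univ_zero,
    Matrix.cons_val_succ, Fin.isValue, Fin.succ_zero_eq_one, Fin.succ_one_eq_two]
  simp (config := { decide := true }) only [if_true, if_false]
  norm_num

/-- **(T3) fails at the UNIFORM measure on six coins** (it holds at `q ≡ 1/2` on all of `{0,1}^5`, exhaustive census; the tree's uniform instance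
`SahiCoordinateTwoThirdsFalse` has seven coins). [this work] -/
theorem twoThirds_fails_on_fin_six_uniform :
    ∃ (p : Fin 6 → unitInterval) (A B C : Set (Set (Fin 6))) (e : Fin 6), (∀ i, (p i : ℝ) = 1 / 2) ∧ IsUpperSet A ∧ IsUpperSet B ∧ IsUpperSet C ∧
      coordPiece₂ p e ![A, B, C] +
        sahiE (bernoulliWeight p) 3 ![ind (secAt e false A), ind (secAt e false B), ind (secAt e false C)] < 0 := by
  have h2 : (1/2 : ℝ) ∈ unitInterval := ⟨by norm_num, by norm_num⟩
  refine ⟨fun _ => ⟨1/2, h2⟩, _, _, _, 2, fun _ => rfl, isUpperSet_witness6A, isUpperSet_witness6B, isUpperSet_witness6C, ?_⟩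
  rw [witness6_value h2]
  norm_num

end SahiCoordinateTwoThirds

end Summit.CriticalPhenomena.PercolationContinuityZ3.Theorems
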